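import Mathlib
import Summits.AtomisticToContinuum.Crystallization.Theses.PhononSlackCertificates
import Summits.AtomisticToContinuum.Crystallization.Theorems.PhononSlackCertificatesNearFarGlueRLooseReduction
import Summits.AtomisticToContinuum.Crystallization.Theorems.PhononSlackCertificatesNearFarGlueRLooseTarget
import Literature.MathematicalPhysics.StatisticalMechanics.LennardJonesClusters

/-!
# Crux `PhononSlackCertificates.NearFarGlueR` (stmt-AtomisticToContinuum-14970), line `Sketch`:
the residual (and the target) may assume WELL-BONDED configurations

Continuation lead c4 (registered sub-goal `stub_wellBondedReduction` of the crux item, skeleton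
`Lines/Sketch.lean`).  The θ-parametric sharpening of c3's loose exhaustion
(`PhononSlackCertificatesNearFarGlueRLooseExhaustion`, `…LooseReduction`, `…LooseTarget`).  With the
half-repulsion site functional `A_j(x) = Σ_{k≠j} (min(V,0) + ½·max(V,0))(|x_j − x_k|)`, call a
particle `θ`-WELL-BONDED if `A_j(x) < −θ`; for `θ ∈ [0, 0.711)`:

* `strip_round_loose` (§1): removing the set `W` of particles with `A_j ≥ −θ` costs
  `(0.711 − θ)·#W ≤ [𝓔(x) − N·e*] − [𝓔(x|Wᶜ) − #Wᶜ·e*]` — the restriction identity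
  (`interactionEnergy_eq_restrict_add`), `loose_sum_le`, and the tree's certified `e* ≤ −0.711`
  (`OnePercentFccRung.eStar_le_neg`);
* `exists_wellBonded_core` (§1): every finite configuration has a `θ`-well-bonded sub-configuration
  `x ∘ f`, `f : Fin K ↪ Fin N`, with `[𝓔(x ∘ f) − K·e*] + (0.711 − θ)·(N − K) ≤ 𝓔(x) − N·e*`
  (strong induction on `N`);
* `tightContact_ineq_of_wellBonded`, `tightContactGap_iff_wellBonded` (§2): since `θ ≥ 0`, a
  well-bonded core is net-bound, hence `3/10`-separated (`sep_of_netBound`), so c3's transfer of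
  tight contacts `card_contact_le_strip` (`#T(x) ≤ 5833·(N − K) + #T(x ∘ f)`) applies verbatim: the
  registered residual `stub_tightContactGap` is EQUIVALENT to its instance on `θ`-well-bonded
  injective configurations, with constant `min g ((0.711 − θ)/5833)`;
* `coercive_ineq_of_wellBonded`, `coerciveTwoShellGap_iff_wellBonded` (§3): the same for the
  route's TARGET `CoerciveTwoShellGap`, via `card_bad_le_strip` (constant `1332`).

So whoever attacks the promoted residual may assume every particle bound at least like a kink atom
(`A_j < −θ`, any fixed `θ < 0.711`), all distances `≥ 3/10`.  All `[folklore]`.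
-/

noncomputable section

namespace Summit.AtomisticToContinuum.Crystallization.Theorems.PhononSlackCertificatesNearFarGlueR

open Literature.MathematicalPhysics.StatisticalMechanics
open Literature.Geometry.DiscreteGeometry
open Summit.AtomisticToContinuum.Crystallization.Theses.PhononSlackCertificates
open Summit.AtomisticToContinuum.Crystallization.Theorems.OnePercentFccRung (eStar_le_neg)
open scoped BigOperators

/-! ## §1 Well-bonded exhaustion -/

/-- One `θ`-stripping round: removing the set `W` of particles with `A_j ≥ −θ` costs at most
`(0.711 − θ)·#W` — `[𝓔(x|Wᶜ) − #Wᶜ·e*] + (711/1000 − θ)·#W ≤ 𝓔(x) − N·e*`. [folklore] -/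
theorem strip_round_loose {N K : ℕ} (x : Fin N → EuclideanSpace ℝ (Fin 3)) (W : Finset (Fin N))
    (f : Fin K ↪ Fin N) (hmap : Finset.univ.map f = Wᶜ) (θ : ℝ)
    (hW : ∀ j ∈ W, -θ ≤ ∑ k ∈ Finset.univ.erase j,
      (min (lennardJones (dist (x j) (x k))) 0 + (1 / 2 : ℝ) * max (lennardJones (dist (x j) (x k))) 0)) :
    interactionEnergy lennardJones (x ∘ f) -
        (K : ℝ) * (⨅ Q : PeriodicConfiguration 3, Q.energyPerParticle lennardJones) +
        (711 / 1000 - θ) * (W.card : ℝ) ≤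
      interactionEnergy lennardJones x -
        (N : ℝ) * (⨅ Q : PeriodicConfiguration 3, Q.energyPerParticle lennardJones) := by
  have hid := interactionEnergy_eq_restrict_add x W f hmap
  have hle := loose_sum_le x W
  have hsum : ∑ j ∈ W, (-θ) ≤ ∑ j ∈ W, ∑ k ∈ Finset.univ.erase j,
      (min (lennardJones (dist (x j) (x k))) 0 +
        (1 / 2 : ℝ) * max (lennardJones (dist (x j) (x k))) 0) := Finset.sum_le_sum hW
  rw [Finset.sum_const, nsmul_eq_mul] at hsum
  have hK : (K : ℝ) = (N : ℝ) - (W.card : ℝ) := by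
    have h1 : (Finset.univ.map f).card = Wᶜ.card := by rw [hmap]
    rw [Finset.card_map, Finset.card_univ, Fintype.card_fin, Finset.card_compl,
      Fintype.card_fin] at h1
    rw [h1, Nat.cast_sub (by simpa using W.card_le_univ)]
  have hstar : (⨅ Q : PeriodicConfiguration 3, Q.energyPerParticle lennardJones) ≤ -(711 / 1000 : ℝ) :=
    eStar_le_neg
  have hW0 : 0 ≤ (W.card : ℝ) := Nat.cast_nonneg _
  rw [hK]
  nlinarith [hid, hle, hsum, mul_le_mul_of_nonneg_left hstar hW0]

/-- **Well-bonded exhaustion.**  Every finite configuration `x` has a `θ`-WELL-BONDED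
sub-configuration `x ∘ f` (`f : Fin K ↪ Fin N`, `A_k(x ∘ f) < −θ` for every `k`) with
`[𝓔(x ∘ f) − K·e*] + (711/1000 − θ)·(N − K) ≤ 𝓔(x) − N·e*` (strong induction on `N`, one
`θ`-stripping round at a time). [folklore] -/
theorem exists_wellBonded_core (θ : ℝ) :
    ∀ (N : ℕ) (x : Fin N → EuclideanSpace ℝ (Fin 3)),
      ∃ (K : ℕ) (f : Fin K ↪ Fin N),
        (∀ k : Fin K, ∑ l ∈ Finset.univ.erase k,
          (min (lennardJones (dist (x (f k)) (x (f l)))) 0 +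
            (1 / 2 : ℝ) * max (lennardJones (dist (x (f k)) (x (f l)))) 0) < -θ) ∧
        interactionEnergy lennardJones (x ∘ f) -
            (K : ℝ) * (⨅ Q : PeriodicConfiguration 3, Q.energyPerParticle lennardJones) +
            (711 / 1000 - θ) * ((N : ℝ) - K) ≤
          interactionEnergy lennardJones x -
            (N : ℝ) * (⨅ Q : PeriodicConfiguration 3, Q.energyPerParticle lennardJones) := by
  classical
  intro N
  induction N using Nat.strong_induction_on with
  | _ N ih =>
    intro x
    set W := Finset.univ.filter fun j : Fin N => -θ ≤ ∑ k ∈ Finset.univ.erase j,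
      (min (lennardJones (dist (x j) (x k))) 0 +
        (1 / 2 : ℝ) * max (lennardJones (dist (x j) (x k))) 0) with hW
    by_cases hW0 : W = ∅
    · -- already well-bonded: keep everything
      refine ⟨N, Function.Embedding.refl _, fun k => ?_, ?_⟩
      · have hk : k ∉ W := by rw [hW0]; exact Finset.notMem_empty _
        have hlt' : ∑ l ∈ Finset.univ.erase k,
            (min (lennardJones (dist (x k) (x l))) 0 +
              (1 / 2 : ℝ) * max (lennardJones (dist (x k) (x l))) 0) < -θ :=
          not_le.1 fun h => hk (Finset.mem_filter.2 ⟨Finset.mem_univ _, h⟩)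
        simpa using hlt'
      · have hE0 : interactionEnergy lennardJones (x ∘ ⇑(Function.Embedding.refl (Fin N))) =
            interactionEnergy lennardJones x := rfl
        rw [hE0]
        simp
    · -- strip W and recurse
      set f₀ := (Wᶜ).orderEmbOfFin rfl with hf₀
      have hmap : Finset.univ.map f₀.toEmbedding = Wᶜ := Finset.map_orderEmbOfFin_univ Wᶜ rfl
      have hWpos : 0 < W.card := Finset.card_pos.2 (Finset.nonempty_iff_ne_empty.2 hW0)
      have hlt : Wᶜ.card < N := by
        rw [Finset.card_compl, Fintype.card_fin]
        have : W.card ≤ N := by simpa using W.card_le_univ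
        omega
      obtain ⟨K, f₁, hwb, hE⟩ := ih _ hlt (x ∘ f₀.toEmbedding)
      refine ⟨K, f₁.trans f₀.toEmbedding, fun k => by simpa using hwb k, ?_⟩
      have hround := strip_round_loose x W f₀.toEmbedding hmap θ
        (fun j hj => (Finset.mem_filter.1 hj).2)
      have hK : ((Wᶜ.card : ℕ) : ℝ) = (N : ℝ) - (W.card : ℝ) := by
        rw [Finset.card_compl, Fintype.card_fin, Nat.cast_sub (by simpa using W.card_le_univ)]
      rw [hK] at hE hround
      have hcomp : interactionEnergy lennardJones (x ∘ ⇑(f₁.trans f₀.toEmbedding)) =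
          interactionEnergy lennardJones ((x ∘ f₀.toEmbedding) ∘ f₁) := rfl
      rw [hcomp]
      linarith [hround, hE]

/-- A `θ`-well-bonded configuration with `θ ≥ 0` is net-bound. [folklore] -/
theorem netBound_of_wellBonded {θ : ℝ} (hθ0 : 0 ≤ θ) {N : ℕ} {x : Fin N → EuclideanSpace ℝ (Fin 3)}
    (hwb : ∀ j : Fin N, ∑ k ∈ Finset.univ.erase j,
      (min (lennardJones (dist (x j) (x k))) 0 + (1 / 2 : ℝ) * max (lennardJones (dist (x j) (x k))) 0) < -θ) :
    ∀ j : Fin N, ∑ k ∈ Finset.univ.erase j,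
      (min (lennardJones (dist (x j) (x k))) 0 + (1 / 2 : ℝ) * max (lennardJones (dist (x j) (x k))) 0) < 0 :=
  fun j => (hwb j).trans_le (neg_nonpos.2 hθ0)

/-! ## §2 The residual may assume well-bonded configurations -/

/-- **The residual reduces to `θ`-well-bonded configurations** (`0 ≤ θ ≤ 0.711`).  If
`K·e* + g·#T(z) ≤ 𝓔(z)` for every `θ`-well-bonded injective `z` (`A_k(z) < −θ` for all `k`; such
`z` are net-bound, hence `3/10`-separated) with one `g ≥ 0`, then
`N·e* + min g ((711/1000 − θ)/5833)·#T(x) ≤ 𝓔(x)` for EVERY finite injective `x`. [folklore] -/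
theorem tightContact_ineq_of_wellBonded {g θ : ℝ} (hg : 0 ≤ g) (hθ0 : 0 ≤ θ) (hθ : θ ≤ 711 / 1000)
    (H : ∀ (K : ℕ) (z : Fin K → EuclideanSpace ℝ (Fin 3)), Function.Injective z →
      (∀ k : Fin K, ∑ l ∈ Finset.univ.erase k,
        (min (lennardJones (dist (z k) (z l))) 0 + (1 / 2 : ℝ) * max (lennardJones (dist (z k) (z l))) 0) < -θ) →
      (K : ℝ) * (⨅ Q : PeriodicConfiguration 3, Q.energyPerParticle lennardJones) +
          g * (Nat.card {k : Fin K // ¬ IsTwoShellGood (1 / 20) (47 / 50) 1 z k ∧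
            ∃ i : Fin K, IsTwoShellGood (1 / 20) (47 / 50) 1 z i ∧ dist (z i) (z k) ≤ 21 / 20} : ℝ) ≤
        interactionEnergy lennardJones z)
    {N : ℕ} (x : Fin N → EuclideanSpace ℝ (Fin 3)) (hx : Function.Injective x) :
    (N : ℝ) * (⨅ Q : PeriodicConfiguration 3, Q.energyPerParticle lennardJones) +
        min g ((711 / 1000 - θ) / 5833) *
          (Nat.card {j : Fin N // ¬ IsTwoShellGood (1 / 20) (47 / 50) 1 x j ∧
            ∃ i : Fin N, IsTwoShellGood (1 / 20) (47 / 50) 1 x i ∧ dist (x i) (x j) ≤ 21 / 20} : ℝ) ≤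
      interactionEnergy lennardJones x := by
  obtain ⟨K, f, hwb, hE⟩ := exists_wellBonded_core θ N x
  have hzinj : Function.Injective (x ∘ f) := hx.comp f.injective
  have hnet : ∀ k : Fin K, ∑ l ∈ Finset.univ.erase k,
      (min (lennardJones (dist ((x ∘ f) k) ((x ∘ f) l))) 0 +
        (1 / 2 : ℝ) * max (lennardJones (dist ((x ∘ f) k) ((x ∘ f) l))) 0) < 0 :=
    netBound_of_wellBonded hθ0 hwb
  have hsep : ∀ k l : Fin K, k ≠ l → (3 / 10 : ℝ) ≤ dist (x (f k)) (x (f l)) :=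
    sep_of_netBound (x ∘ f) hzinj hnet
  have hH := H K (x ∘ f) hzinj hwb
  have hcount := card_contact_le_strip x f hsep
  set m : ℝ := min g ((711 / 1000 - θ) / 5833) with hm
  have hm0 : 0 ≤ m := le_min hg (div_nonneg (by linarith) (by norm_num))
  have hmg : m ≤ g := min_le_left _ _
  have hm2 : m * 5833 ≤ 711 / 1000 - θ := by
    have : m ≤ (711 / 1000 - θ) / 5833 := min_le_right _ _
    exact (le_div_iff₀ (by norm_num)).1 this
  set tN : ℝ := (Nat.card {j : Fin N // ¬ IsTwoShellGood (1 / 20) (47 / 50) 1 x j ∧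
      ∃ i : Fin N, IsTwoShellGood (1 / 20) (47 / 50) 1 x i ∧ dist (x i) (x j) ≤ 21 / 20} : ℝ) with htN
  set tK : ℝ := (Nat.card {k : Fin K // ¬ IsTwoShellGood (1 / 20) (47 / 50) 1 (x ∘ f) k ∧
      ∃ i : Fin K, IsTwoShellGood (1 / 20) (47 / 50) 1 (x ∘ f) i ∧
        dist ((x ∘ f) i) ((x ∘ f) k) ≤ 21 / 20} : ℝ) with htK
  have htK0 : 0 ≤ tK := Nat.cast_nonneg _
  have hNK : 0 ≤ (N : ℝ) - K := by
    have : K ≤ N := by simpa using Fintype.card_le_of_embedding f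
    have : (K : ℝ) ≤ N := by exact_mod_cast this
    linarith
  have h1 : m * tN ≤ m * tK + m * 5833 * ((N : ℝ) - K) := by
    have := mul_le_mul_of_nonneg_left hcount hm0
    nlinarith [this]
  have h2 : m * tK ≤ g * tK := mul_le_mul_of_nonneg_right hmg htK0
  have h3 : m * 5833 * ((N : ℝ) - K) ≤ (711 / 1000 - θ) * ((N : ℝ) - K) :=
    mul_le_mul_of_nonneg_right hm2 hNK
  have hH' : (K : ℝ) * (⨅ Q : PeriodicConfiguration 3, Q.energyPerParticle lennardJones) + g * tK ≤
      interactionEnergy lennardJones (x ∘ f) := hH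
  linarith [hE, hH', h1, h2, h3]

/-- **The registered residual is equivalent to its `θ`-WELL-BONDED instance** (`0 ≤ θ < 0.711`):
it suffices to prove the tight contact gap, with one `g₂ > 0`, for injective configurations all of
whose particles satisfy `A_j < −θ` (bound at least like a kink atom when `θ` is close to `0.711`;
these are `3/10`-separated and uncrowded). [folklore] -/
theorem tightContactGap_iff_wellBonded {θ : ℝ} (hθ0 : 0 ≤ θ) (hθ : θ < 711 / 1000) :
    (∀ δ : ℝ, 0 < δ → ∃ g₂ : ℝ, 0 < g₂ ∧ ∀ (N : ℕ) (x : Fin N → EuclideanSpace ℝ (Fin 3)),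
      (∀ i j : Fin N, i ≠ j → δ ≤ dist (x i) (x j)) →
      (N : ℝ) * (⨅ Q : PeriodicConfiguration 3, Q.energyPerParticle lennardJones)
        + g₂ * (Nat.card {j : Fin N // ¬ IsTwoShellGood (1 / 20) (47 / 50) 1 x j ∧
            ∃ i : Fin N, IsTwoShellGood (1 / 20) (47 / 50) 1 x i ∧ dist (x i) (x j) ≤ 21 / 20} : ℝ)
        ≤ interactionEnergy lennardJones x) ↔
    (∃ g₂ : ℝ, 0 < g₂ ∧ ∀ (N : ℕ) (x : Fin N → EuclideanSpace ℝ (Fin 3)), Function.Injective x →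
      (∀ j : Fin N, ∑ k ∈ Finset.univ.erase j,
        (min (lennardJones (dist (x j) (x k))) 0 +
          (1 / 2 : ℝ) * max (lennardJones (dist (x j) (x k))) 0) < -θ) →
      (N : ℝ) * (⨅ Q : PeriodicConfiguration 3, Q.energyPerParticle lennardJones)
        + g₂ * (Nat.card {j : Fin N // ¬ IsTwoShellGood (1 / 20) (47 / 50) 1 x j ∧
            ∃ i : Fin N, IsTwoShellGood (1 / 20) (47 / 50) 1 x i ∧ dist (x i) (x j) ≤ 21 / 20} : ℝ)
        ≤ interactionEnergy lennardJones x) := by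
  constructor
  · intro h
    obtain ⟨g, hg, H⟩ := h (3 / 10) (by norm_num)
    exact ⟨g, hg, fun N x hx hwb => H N x (sep_of_netBound x hx (netBound_of_wellBonded hθ0 hwb))⟩
  · rintro ⟨g, hg, H⟩ δ hδ
    refine ⟨min g ((711 / 1000 - θ) / 5833), lt_min hg (div_pos (by linarith) (by norm_num)),
      fun N x hsep => ?_⟩
    exact tightContact_ineq_of_wellBonded hg.le hθ0 hθ.le H x (fibre_injective_of_separated hδ hsep)

/-- **The residual, once true on well-bonded configurations, holds WITHOUT any hypothesis**: one
`g₂ > 0` with `N·e* + g₂·#T(x) ≤ 𝓔_LJ(x)` for every finite injective configuration. [folklore] -/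
theorem tightContact_ineq_of_tightContactGap_wellBonded {θ : ℝ} (hθ0 : 0 ≤ θ) (hθ : θ < 711 / 1000)
    (h : ∃ g₂ : ℝ, 0 < g₂ ∧ ∀ (N : ℕ) (x : Fin N → EuclideanSpace ℝ (Fin 3)), Function.Injective x →
      (∀ j : Fin N, ∑ k ∈ Finset.univ.erase j,
        (min (lennardJones (dist (x j) (x k))) 0 +
          (1 / 2 : ℝ) * max (lennardJones (dist (x j) (x k))) 0) < -θ) →
      (N : ℝ) * (⨅ Q : PeriodicConfiguration 3, Q.energyPerParticle lennardJones)
        + g₂ * (Nat.card {j : Fin N // ¬ IsTwoShellGood (1 / 20) (47 / 50) 1 x j ∧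
            ∃ i : Fin N, IsTwoShellGood (1 / 20) (47 / 50) 1 x i ∧ dist (x i) (x j) ≤ 21 / 20} : ℝ)
        ≤ interactionEnergy lennardJones x) :
    ∃ g₂ : ℝ, 0 < g₂ ∧ ∀ (N : ℕ) (x : Fin N → EuclideanSpace ℝ (Fin 3)), Function.Injective x →
      (N : ℝ) * (⨅ Q : PeriodicConfiguration 3, Q.energyPerParticle lennardJones)
        + g₂ * (Nat.card {j : Fin N // ¬ IsTwoShellGood (1 / 20) (47 / 50) 1 x j ∧
            ∃ i : Fin N, IsTwoShellGood (1 / 20) (47 / 50) 1 x i ∧ dist (x i) (x j) ≤ 21 / 20} : ℝ)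
        ≤ interactionEnergy lennardJones x := by
  obtain ⟨g, hg, H⟩ := h
  exact ⟨min g ((711 / 1000 - θ) / 5833), lt_min hg (div_pos (by linarith) (by norm_num)),
    fun N x hx => tightContact_ineq_of_wellBonded hg.le hθ0 hθ.le H x hx⟩

/-! ## §3 The target may assume well-bonded configurations -/

/-- **The target reduces to `θ`-well-bonded configurations** (`0 ≤ θ ≤ 0.711`).  If
`K·e* + g·#bad(z) ≤ 𝓔(z)` for every `θ`-well-bonded injective `z` with one `g ≥ 0`, then
`N·e* + min g ((711/1000 − θ)/1332)·#bad(x) ≤ 𝓔(x)` for every finite injective `x`. [folklore] -/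
theorem coercive_ineq_of_wellBonded {g θ : ℝ} (hg : 0 ≤ g) (hθ0 : 0 ≤ θ) (hθ : θ ≤ 711 / 1000)
    (H : ∀ (K : ℕ) (z : Fin K → EuclideanSpace ℝ (Fin 3)), Function.Injective z →
      (∀ k : Fin K, ∑ l ∈ Finset.univ.erase k,
        (min (lennardJones (dist (z k) (z l))) 0 + (1 / 2 : ℝ) * max (lennardJones (dist (z k) (z l))) 0) < -θ) →
      (K : ℝ) * (⨅ Q : PeriodicConfiguration 3, Q.energyPerParticle lennardJones) +
          g * (Nat.card {k : Fin K // ¬ IsTwoShellGood (1 / 20) (47 / 50) 1 z k} : ℝ) ≤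
        interactionEnergy lennardJones z)
    {N : ℕ} (x : Fin N → EuclideanSpace ℝ (Fin 3)) (hx : Function.Injective x) :
    (N : ℝ) * (⨅ Q : PeriodicConfiguration 3, Q.energyPerParticle lennardJones) +
        min g ((711 / 1000 - θ) / 1332) *
          (Nat.card {i : Fin N // ¬ IsTwoShellGood (1 / 20) (47 / 50) 1 x i} : ℝ) ≤
      interactionEnergy lennardJones x := by
  obtain ⟨K, f, hwb, hE⟩ := exists_wellBonded_core θ N x
  have hzinj : Function.Injective (x ∘ f) := hx.comp f.injective
  have hnet : ∀ k : Fin K, ∑ l ∈ Finset.univ.erase k,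
      (min (lennardJones (dist ((x ∘ f) k) ((x ∘ f) l))) 0 +
        (1 / 2 : ℝ) * max (lennardJones (dist ((x ∘ f) k) ((x ∘ f) l))) 0) < 0 :=
    netBound_of_wellBonded hθ0 hwb
  have hsep : ∀ k l : Fin K, k ≠ l → (3 / 10 : ℝ) ≤ dist (x (f k)) (x (f l)) :=
    sep_of_netBound (x ∘ f) hzinj hnet
  have hH := H K (x ∘ f) hzinj hwb
  have hcount := card_bad_le_strip x f hsep
  set m : ℝ := min g ((711 / 1000 - θ) / 1332) with hm
  have hm0 : 0 ≤ m := le_min hg (div_nonneg (by linarith) (by norm_num))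
  have hmg : m ≤ g := min_le_left _ _
  have hm2 : m * 1332 ≤ 711 / 1000 - θ := by
    have : m ≤ (711 / 1000 - θ) / 1332 := min_le_right _ _
    exact (le_div_iff₀ (by norm_num)).1 this
  set bN : ℝ := (Nat.card {i : Fin N // ¬ IsTwoShellGood (1 / 20) (47 / 50) 1 x i} : ℝ) with hbN
  set bK : ℝ := (Nat.card {k : Fin K // ¬ IsTwoShellGood (1 / 20) (47 / 50) 1 (x ∘ f) k} : ℝ) with hbK
  have hbK0 : 0 ≤ bK := Nat.cast_nonneg _
  have hNK : 0 ≤ (N : ℝ) - K := by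
    have : K ≤ N := by simpa using Fintype.card_le_of_embedding f
    have : (K : ℝ) ≤ N := by exact_mod_cast this
    linarith
  have h1 : m * bN ≤ m * bK + m * 1332 * ((N : ℝ) - K) := by
    have := mul_le_mul_of_nonneg_left hcount hm0
    nlinarith [this]
  have h2 : m * bK ≤ g * bK := mul_le_mul_of_nonneg_right hmg hbK0
  have h3 : m * 1332 * ((N : ℝ) - K) ≤ (711 / 1000 - θ) * ((N : ℝ) - K) :=
    mul_le_mul_of_nonneg_right hm2 hNK
  have hH' : (K : ℝ) * (⨅ Q : PeriodicConfiguration 3, Q.energyPerParticle lennardJones) + g * bK ≤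
      interactionEnergy lennardJones (x ∘ f) := hH
  linarith [hE, hH', h1, h2, h3]

/-- **The target is equivalent to its `θ`-well-bonded instance** (`0 ≤ θ < 0.711`). [folklore] -/
theorem coerciveTwoShellGap_iff_wellBonded {θ : ℝ} (hθ0 : 0 ≤ θ) (hθ : θ < 711 / 1000) :
    CoerciveTwoShellGap ↔
    (∃ g : ℝ, 0 < g ∧ ∀ (N : ℕ) (x : Fin N → EuclideanSpace ℝ (Fin 3)), Function.Injective x →
      (∀ j : Fin N, ∑ k ∈ Finset.univ.erase j,
        (min (lennardJones (dist (x j) (x k))) 0 + (1 / 2 : ℝ) * max (lennardJones (dist (x j) (x k))) 0) < -θ) →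
      (N : ℝ) * (⨅ Q : PeriodicConfiguration 3, Q.energyPerParticle lennardJones) +
          g * (Nat.card {i : Fin N // ¬ IsTwoShellGood (1 / 20) (47 / 50) 1 x i} : ℝ) ≤
        interactionEnergy lennardJones x) := by
  constructor
  · intro h
    obtain ⟨g, hg, H⟩ := h (3 / 10) (by norm_num)
    exact ⟨g, hg, fun N x hx hwb => H N x (sep_of_netBound x hx (netBound_of_wellBonded hθ0 hwb))⟩
  · rintro ⟨g, hg, H⟩ δ hδ
    refine ⟨min g ((711 / 1000 - θ) / 1332), lt_min hg (div_pos (by linarith) (by norm_num)),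
      fun N x hsep => ?_⟩
    exact coercive_ineq_of_wellBonded hg.le hθ0 hθ.le H x (fibre_injective_of_separated hδ hsep)

/-! ## §4 The registered sub-goal -/

/-- **Registered sub-goal `stub_wellBondedReduction` of the crux item** (skeleton
`Lines/Sketch.lean`, c4): for every `θ ∈ [0, 0.711)` the registered residual is EQUIVALENT to its
instance on `θ`-well-bonded configurations — `tightContactGap_iff_wellBonded` in closed form.
[folklore] -/
theorem stub_wellBondedReduction :
    ∀ θ : ℝ, 0 ≤ θ → θ < 711 / 1000 →
    ((∀ δ : ℝ, 0 < δ → ∃ g₂ : ℝ, 0 < g₂ ∧ ∀ (N : ℕ) (x : Fin N → EuclideanSpace ℝ (Fin 3)),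
      (∀ i j : Fin N, i ≠ j → δ ≤ dist (x i) (x j)) →
      (N : ℝ) * (⨅ Q : PeriodicConfiguration 3, Q.energyPerParticle lennardJones)
        + g₂ * (Nat.card {j : Fin N // ¬ IsTwoShellGood (1 / 20) (47 / 50) 1 x j ∧
            ∃ i : Fin N, IsTwoShellGood (1 / 20) (47 / 50) 1 x i ∧ dist (x i) (x j) ≤ 21 / 20} : ℝ)
        ≤ interactionEnergy lennardJones x) ↔
    (∃ g₂ : ℝ, 0 < g₂ ∧ ∀ (N : ℕ) (x : Fin N → EuclideanSpace ℝ (Fin 3)), Function.Injective x →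
      (∀ j : Fin N, ∑ k ∈ Finset.univ.erase j,
        (min (lennardJones (dist (x j) (x k))) 0 +
          (1 / 2 : ℝ) * max (lennardJones (dist (x j) (x k))) 0) < -θ) →
      (N : ℝ) * (⨅ Q : PeriodicConfiguration 3, Q.energyPerParticle lennardJones)
        + g₂ * (Nat.card {j : Fin N // ¬ IsTwoShellGood (1 / 20) (47 / 50) 1 x j ∧
            ∃ i : Fin N, IsTwoShellGood (1 / 20) (47 / 50) 1 x i ∧ dist (x i) (x j) ≤ 21 / 20} : ℝ)
        ≤ interactionEnergy lennardJones x)) :=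
  fun _θ hθ0 hθ => tightContactGap_iff_wellBonded hθ0 hθ

end Summit.AtomisticToContinuum.Crystallization.Theorems.PhononSlackCertificatesNearFarGlueR

end
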